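import Literature.Probability.RandomPlanarGeometry.SAWPulledLargeForceExpansionZdThirdOrder
import Literature.Probability.RandomPlanarGeometry.SAWPulledLargeForceExpansionZdHeights
import Literature.Probability.RandomPlanarGeometry.SAWIrreducibleBridgeThreeSpan
import HarnessLib

/-!
# The pulled self-avoiding walk on `ℤ^{d+1}` at large force: THE FOURTH COEFFICIENT `c^{(d)}_4 = −4d²(2d+3)` —
# `e^{λ_B(y)} = y + 2d − 2d/y + 2d(2d+1)/y² − 4d²(2d+3)/y³ + O(1/y⁴)` in every dimension

Topic `Literature/Probability/RandomPlanarGeometry` (continues `SAWPulledLargeForceExpansionZdThirdOrder.lean` (generic moments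
`pS/pD/pH`, `coeff_Pz_comp_zero/one/two`, `e_three`, the cost-three census), `SAWPulledLargeForceExpansionZdHeights.lean`
(height-profile tools: `no_up_down_of_mem_saws`, `no_down_up_of_mem_saws`, `not_irreducible_of_monotone`) and
`SAWIrreducibleBridgeThreeSpan.lean` (`3 · span ≤ n` for irreducible bridges of span `≥ 2`)).

Printed sources: E. J. Janse van Rensburg, S. G. Whittington, J. Phys. A 46 (2013) 435003, §3.2 Theorem 8 (first order, square
lattice); N. Madras, G. Slade, *The Self-Avoiding Walk* (1993), §4.2 (renewal structure of bridges, remark after Theorem 4.2.4).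
The fourth coefficient in general dimension is not in print (lane «pcv-sawmu»).

## Contents (all PROVED, standard axioms only; no data, no certificates)

* generic (`namespace CostSeries`): `coeff_A_zero_eq_one`, `a_zero`; ★ the convolution identity `A_K · E_K = 1 − (1 − A_K)^{K+1}`
  (`A_mul_E`) and `Σ_{i+j=k} a_i e_j = 0` for `k ≥ 1` (`sum_antidiagonal_a_mul_e`) — the inverse coefficients `e_k` from the
  expansion coefficients `a_k` of `u`; the recursion `a_{K+1} = −Σ_{j ≤ K} [X^{K−j}](P_{j+1} ∘ A_K)` (`a_succ`); third coefficients of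
  powers and compositions (`coeff_pow_three`, `pT`, `coeff_Pz_comp_three`); ★ `a_one … a_four` in the moments `pS, pD, pH, pT`;
  ★ `e_four_eq : e_4 = −(a_1 e_3 + a_2 e_2 + a_3 e_1 + a_4)`.
* support of the cost data on `ℤ^{d+1}`: `costCoeffZd_eq_zero_of_le` (`N_{c,n} = 0` for `n ≤ c`) and ★ `costCoeffZd_eq_zero_of_three_span`
  (`N_{c,n} = 0` for `n ≥ c + 2` with `2n > 3c`, from the three-span lemma) — so cost `4` lives on lengths `5, 6` only.
* the cost-four census: ★ `costCoeffZd_four_five` (`N_{4,5} = 2d(2d−1)³ − 2d(2d−2)`: five steps `+e₀, v₁, …, v₄`, transverse, no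
  immediate reversal, not a unit square — `fiveStep`, `fiveStepIndex`, the four-vector lemma `eq_revIdx_of_sum_four_eq_zero`),
  ★ `costCoeffZd_four_six` (`N_{4,6} = 2d(2d−1)`: the hooks `+e₀,+e₀,v,−e₀,w,+e₀`, `w ≠ −v`, height profile `0,1,2,2,1,1,2` forced),
  `costCoeffZd_four_seven` (`= 0`), ★ `costCoeffZd_four`.
* ★★ **`largeForceCoeffZd_at_four : largeForceCoeffZd d 4 = −4d²(2d+3)`** (`ℤ²`: `largeForceCoeff_four_eq : largeForceCoeff 4 = −20`,
  certificate-free), and ★★ `exp_pulledBridgeFreeEnergy_fourth_order_zd`.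

Provenance: lane «pcv-sawmu», a-p3 g16 (2026-08-24); the value `−4d²(2d+3)` was first observed numerically (kit census j223029, a-p3 g15).
-/

noncomputable section

open Finset Filter Topology
open scoped BigOperators
open Literature.Probability.LatticeModels
open Literature.Probability.RandomPlanarGeometry.SAW

namespace Literature.Probability.RandomPlanarGeometry.SAW.Zd

namespace CostSeries

variable (N : ℕ → ℕ → ℕ)

/-! ### Generic: the convolution identity between the `u`-coefficients `a_k` and the inverse coefficients `e_k` -/

/-- `A_K(0) = 1` for every `K`. [cite: JansevanRensburgWhittington2013, §3.2 Theorem 8 (arXiv v4 p. 11)] -/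
theorem coeff_A_zero_eq_one : ∀ K, (A N K).coeff 0 = 1
  | 0 => by simp [A]
  | K + 1 => by
    show ((1 : Polynomial ℤ) - ∑ j ∈ Finset.range (K + 1), Polynomial.X ^ (j + 1) * (Pz N (j + 1)).comp (A N K)).coeff 0 = 1
    rw [Polynomial.coeff_sub, Polynomial.coeff_one_zero, Polynomial.finsetSum_coeff]
    simp

/-- `a_0 = 1`. [cite: JansevanRensburgWhittington2013, §3.2 Theorem 8 (arXiv v4 p. 11)] -/
theorem a_zero : a N 0 = 1 := coeff_A_zero_eq_one N 0

/-- `X ∣ 1 − A_K`. [cite: JansevanRensburgWhittington2013, §3.2 Theorem 8 (arXiv v4 p. 11)] -/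
theorem X_dvd_one_sub_A (K : ℕ) : Polynomial.X ∣ 1 - A N K :=
  Polynomial.X_dvd_iff.2 (by rw [Polynomial.coeff_sub, Polynomial.coeff_one_zero, coeff_A_zero_eq_one, sub_self])

/-- ★ `A_K · E_K = 1 − (1 − A_K)^{K+1}`: `E_K` is the truncated inverse of `A_K`. [cite: JansevanRensburgWhittington2013, §3.2 Theorem 8 (arXiv v4 p. 11)] -/
theorem A_mul_E (K : ℕ) : A N K * E N K = 1 - (1 - A N K) ^ (K + 1) := by
  have h := geom_sum_mul (1 - A N K) (K + 1)
  unfold E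
  linear_combination (-1 : Polynomial ℤ) * h

/-- ★ **The convolution identity** `Σ_{i+j=k} a_i e_j = 0` (`k ≥ 1`): with `a_0 = e_0 = 1` it determines the inverse coefficients
`e_k = [t^k](1/u)` from the coefficients `a_k = [t^k] u`. [cite: JansevanRensburgWhittington2013, §3.2 Theorem 8 (arXiv v4 p. 11)] -/
theorem sum_antidiagonal_a_mul_e {k : ℕ} (hk : 1 ≤ k) : ∑ p ∈ antidiagonal k, a N p.1 * e N p.2 = 0 := by
  have h1 : (A N k * E N k).coeff k = ∑ p ∈ antidiagonal k, a N p.1 * e N p.2 := by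
    rw [Polynomial.coeff_mul]
    refine Finset.sum_congr rfl fun p hp => ?_
    have hp' := Finset.HasAntidiagonal.mem_antidiagonal.1 hp
    rw [coeff_A_eq_a N (show p.1 ≤ k by omega), coeff_E_eq_e N (show p.2 ≤ k by omega)]
  have h2 : (A N k * E N k).coeff k = 0 := by
    rw [A_mul_E, Polynomial.coeff_sub, Polynomial.coeff_one, if_neg (by omega)]
    obtain ⟨q, hq⟩ := pow_dvd_pow_of_dvd (X_dvd_one_sub_A N k) (k + 1)
    rw [hq, Polynomial.coeff_X_pow_mul', if_neg (by omega), sub_zero]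
  rw [← h1, h2]

/-- ★ `e_4 = −(a_1 e_3 + a_2 e_2 + a_3 e_1 + a_4)`. [cite: JansevanRensburgWhittington2013, §3.2 Theorem 8 (arXiv v4 p. 11)] -/
theorem e_four_eq : e N 4 = -(a N 1 * e N 3 + a N 2 * e N 2 + a N 3 * e N 1 + a N 4) := by
  have h := sum_antidiagonal_a_mul_e N (k := 4) (by norm_num)
  rw [Finset.Nat.sum_antidiagonal_eq_sum_range_succ_mk] at h
  simp only [Finset.sum_range_succ, Finset.sum_range_zero, Nat.reduceSub, Nat.sub_self, a_zero, e_zero, zero_add, one_mul,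
    mul_one] at h
  linear_combination h

/-- The same identity at order three: `e_3 = −(a_1 e_2 + a_2 e_1 + a_3)`. [cite: JansevanRensburgWhittington2013, §3.2 Theorem 8 (arXiv v4 p. 11)] -/
theorem e_three_eq : e N 3 = -(a N 1 * e N 2 + a N 2 * e N 1 + a N 3) := by
  have h := sum_antidiagonal_a_mul_e N (k := 3) (by norm_num)
  rw [Finset.Nat.sum_antidiagonal_eq_sum_range_succ_mk] at h
  simp only [Finset.sum_range_succ, Finset.sum_range_zero, Nat.reduceSub, Nat.sub_self, a_zero, e_zero, zero_add, one_mul,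
    mul_one] at h
  linear_combination h

/-! ### Generic: the recursion for `a_{K+1}` and third coefficients -/

/-- ★ `a_{K+1} = −Σ_{j ≤ K} [X^{K−j}](P_{j+1} ∘ A_K)`. [cite: JansevanRensburgWhittington2013, §3.2 Theorem 8 (arXiv v4 p. 11)] -/
theorem a_succ (K : ℕ) : a N (K + 1) = -∑ j ∈ Finset.range (K + 1), ((Pz N (j + 1)).comp (A N K)).coeff (K - j) := by
  show ((1 : Polynomial ℤ) - ∑ j ∈ Finset.range (K + 1), Polynomial.X ^ (j + 1) * (Pz N (j + 1)).comp (A N K)).coeff (K + 1) = _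
  rw [Polynomial.coeff_sub, Polynomial.coeff_one, if_neg (Nat.succ_ne_zero K), zero_sub, Polynomial.finsetSum_coeff]
  congr 1
  refine Finset.sum_congr rfl fun j hj => ?_
  have hj' : j < K + 1 := Finset.mem_range.1 hj
  rw [Polynomial.coeff_X_pow_mul', if_pos (by omega)]
  congr 1
  omega

/-- `pT c = P_c'''(1)/6 = Σ_n C(n,3) N_{c,n}`. [cite: JansevanRensburgWhittington2013, §3.2 Theorem 8 (arXiv v4 p. 11)] -/
def pT (c : ℕ) : ℤ := ∑ n ∈ Finset.range (2 * c + 2), (n.choose 3 : ℤ) * N c n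

/-- The coefficient `3` of `p^n` when `p(0) = 1`: `n p₃ + 2 C(n,2) p₁ p₂ + C(n,3) p₁³`. [cite: JansevanRensburgWhittington2013, §3.2 Theorem 8 (arXiv v4 p. 11)] -/
theorem coeff_pow_three (p : Polynomial ℤ) (h0 : p.coeff 0 = 1) (n : ℕ) :
    (p ^ n).coeff 3 = n * p.coeff 3 + 2 * (n.choose 2 : ℤ) * (p.coeff 1 * p.coeff 2) + (n.choose 3 : ℤ) * p.coeff 1 ^ 3 := by
  induction n with
  | zero => simp [Polynomial.coeff_one]
  | succ n ih =>
    obtain ⟨i0, i1, i2⟩ := coeff_pow_low p h0 n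
    rw [pow_succ, Polynomial.coeff_mul, Finset.Nat.sum_antidiagonal_eq_sum_range_succ_mk]
    simp only [Finset.sum_range_succ, Finset.sum_range_zero, Nat.reduceSub, Nat.sub_self, zero_add]
    rw [i0, i1, i2, ih, h0, Nat.choose_succ_succ n 1, Nat.choose_succ_succ n 2, Nat.choose_one_right]
    push_cast; ring

/-- `[X³](P_c ∘ q) = P_c'(1) q₃ + P_c''(1) q₁ q₂ + (P_c'''(1)/6) q₁³` for `q(0) = 1`. [cite: JansevanRensburgWhittington2013, §3.2 Theorem 8 (arXiv v4 p. 11)] -/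
theorem coeff_Pz_comp_three (c : ℕ) (q : Polynomial ℤ) (h0 : q.coeff 0 = 1) :
    ((Pz N c).comp q).coeff 3 = pD N c * q.coeff 3 + 2 * pH N c * (q.coeff 1 * q.coeff 2) + pT N c * q.coeff 1 ^ 3 := by
  have hH : 2 * pH N c * (q.coeff 1 * q.coeff 2) =
      ∑ n ∈ Finset.range (2 * c + 2), 2 * (n.choose 2 : ℤ) * N c n * (q.coeff 1 * q.coeff 2) := by
    rw [pH, Finset.mul_sum, Finset.sum_mul]
    refine Finset.sum_congr rfl fun n _ => ?_
    ring
  rw [Pz_comp_eq, Polynomial.finsetSum_coeff, pD, pT, hH, Finset.sum_mul, Finset.sum_mul, ← Finset.sum_add_distrib,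
    ← Finset.sum_add_distrib]
  refine Finset.sum_congr rfl fun n _ => ?_
  rw [Polynomial.coeff_C_mul, coeff_pow_three q h0 n]
  ring

/-! ### Generic: the first four `u`-coefficients in the moments of the cost data -/

/-- `a_1 = −pS₁`. [cite: JansevanRensburgWhittington2013, §3.2 Theorem 8 (arXiv v4 p. 11)] -/
theorem a_one : a N 1 = -pS N 1 := (coeff_A_one N).2

/-- `a_2 = pD₁ pS₁ − pS₂`. [cite: JansevanRensburgWhittington2013, §3.2 Theorem 8 (arXiv v4 p. 11)] -/
theorem a_two : a N 2 = pD N 1 * pS N 1 - pS N 2 := (coeff_A_two N).2.2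

/-- ★ `a_3 = −(pD₁ a₂ + pH₁ a₁² + pD₂ a₁ + pS₃)`. [cite: JansevanRensburgWhittington2013, §3.2 Theorem 8 (arXiv v4 p. 11)] -/
theorem a_three : a N 3 = -(pD N 1 * a N 2 + pH N 1 * a N 1 ^ 2 + pD N 2 * a N 1 + pS N 3) := by
  have h0 : (A N 2).coeff 0 = 1 := coeff_A_zero_eq_one N 2
  rw [a_succ]
  simp only [Finset.sum_range_succ, Finset.sum_range_zero, Nat.reduceAdd, Nat.reduceSub, Nat.sub_self, zero_add]
  rw [coeff_Pz_comp_two N 1 _ h0, coeff_Pz_comp_one N 2 _ h0, coeff_Pz_comp_zero N 3 _ h0,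
    coeff_A_eq_a N (show 2 ≤ 2 from le_rfl), coeff_A_eq_a N (show 1 ≤ 2 by norm_num)]

/-- ★ `a_4 = −(pD₁ a₃ + 2 pH₁ a₁ a₂ + pT₁ a₁³ + pD₂ a₂ + pH₂ a₁² + pD₃ a₁ + pS₄)`. [cite: JansevanRensburgWhittington2013, §3.2 Theorem 8 (arXiv v4 p. 11)] -/
theorem a_four : a N 4 = -(pD N 1 * a N 3 + 2 * pH N 1 * (a N 1 * a N 2) + pT N 1 * a N 1 ^ 3 + pD N 2 * a N 2 +
    pH N 2 * a N 1 ^ 2 + pD N 3 * a N 1 + pS N 4) := by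
  have h0 : (A N 3).coeff 0 = 1 := coeff_A_zero_eq_one N 3
  rw [a_succ]
  simp only [Finset.sum_range_succ, Finset.sum_range_zero, Nat.reduceAdd, Nat.reduceSub, Nat.sub_self, zero_add]
  rw [coeff_Pz_comp_three N 1 _ h0, coeff_Pz_comp_two N 2 _ h0, coeff_Pz_comp_one N 3 _ h0, coeff_Pz_comp_zero N 4 _ h0,
    coeff_A_eq_a N (show 3 ≤ 3 from le_rfl), coeff_A_eq_a N (show 2 ≤ 3 by norm_num), coeff_A_eq_a N (show 1 ≤ 3 by norm_num)]
  ring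

end CostSeries

/-! ### Support of the cost data on `ℤ^{d+1}`: `n = c + 1` or `2n ≤ 3c` -/

/-- `N_{c,n} = 0` for `n ≤ c` (an `n`-step bridge has span `≥ 1`, so cost `≤ n − 1`). [cite: MadrasSlade1993, §4.2, eq. (4.2.20)–(4.2.22) (p. 94, 2013 reprint)] -/
theorem costCoeffZd_eq_zero_of_le {d c n : ℕ} (h : n ≤ c) : costCoeffZd d c n = 0 := by
  classical
  rw [costCoeffZd, Finset.card_eq_zero, Finset.filter_eq_empty_iff]
  intro ω hω hc
  obtain ⟨hbr, hI⟩ := mem_irreducibleBridges.1 hω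
  obtain ⟨hωs, hb⟩ := mem_bridges.1 hbr
  have h0 := (mem_saws.1 hωs).1
  have hn1 : 1 ≤ n := hI.1
  have hn0 : 0 < ω n 0 := by have := (hb n hn1 le_rfl).1; rwa [h0] at this
  simp only [costZd] at hc
  omega

/-- ★ **`N_{c,n} = 0` for `n ≥ c + 2` unless `2n ≤ 3c`**: an irreducible bridge of span `n − c ≥ 2` has `3(n − c) ≤ n`
(`three_mul_span_le_of_two_le`, Madras–Slade's remark). [cite: MadrasSlade1993, §4.2, remark after Theorem 4.2.4 (p. 94)] -/
theorem costCoeffZd_eq_zero_of_three_span {d c n : ℕ} (h2 : c + 2 ≤ n) (h3 : 3 * c < 2 * n) : costCoeffZd d c n = 0 := by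
  classical
  rw [costCoeffZd, Finset.card_eq_zero, Finset.filter_eq_empty_iff]
  intro ω hω hc
  have hs := (span_le_and_cost_bound_zd hω).1
  simp only [costZd] at hc
  have h := three_mul_span_le_of_two_le hω (by omega)
  omega

/-- `N_{4,7} = 0` on `ℤ^{d+1}` (a cost-four irreducible bridge of length seven would have span `3` and `9 ≤ 7` steps).
[cite: MadrasSlade1993, §4.2, remark after Theorem 4.2.4 (p. 94)] -/
theorem costCoeffZd_four_seven (d : ℕ) : costCoeffZd d 4 7 = 0 :=
  costCoeffZd_eq_zero_of_three_span (by norm_num) (by norm_num)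


/-! ### The cost-four irreducible bridges of length six: the hooks `+e₀, +e₀, v, −e₀, w, +e₀` (`w ≠ −v`) -/

/-- `x ∼ x + e₀`. [cite: MadrasSlade1993, Definition 1.2.4] -/
theorem adj_add_e0 (d : ℕ) (x : Site (d + 1)) : (zdGraph (d + 1)).Adj x (x + Pi.single 0 1) := by
  rw [zdGraph_adj_iff]; exact ⟨0, Or.inl rfl⟩

/-- The hook `(0, e₀, 2e₀, 2e₀+v, e₀+v, e₀+v+w, 2e₀+v+w)` indexed by `s = (v, w)`. [cite: MadrasSlade1993, Definition 1.2.4] -/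
def hook (d : ℕ) (s : (Fin d × Bool) × (Fin d × Bool)) : ℕ → Site (d + 1) := fun i =>
  if i = 0 then 0 else if i = 1 then Pi.single 0 1 else if i = 2 then Pi.single 0 1 + Pi.single 0 1
  else if i = 3 then Pi.single 0 1 + Pi.single 0 1 + twoStepV d s.1
  else if i = 4 then Pi.single 0 1 + twoStepV d s.1
  else if i = 5 then Pi.single 0 1 + twoStepV d s.1 + twoStepV d s.2
  else Pi.single 0 1 + Pi.single 0 1 + twoStepV d s.1 + twoStepV d s.2

/-- Value at `0`. [cite: MadrasSlade1993, Definition 1.2.4] -/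
@[simp] theorem hook_zero (d : ℕ) (s) : hook d s 0 = 0 := by simp [hook]

/-- Value at `1`. [cite: MadrasSlade1993, Definition 1.2.4] -/
@[simp] theorem hook_one (d : ℕ) (s) : hook d s 1 = Pi.single 0 1 := by simp [hook]

/-- Value at `2`. [cite: MadrasSlade1993, Definition 1.2.4] -/
@[simp] theorem hook_two (d : ℕ) (s) : hook d s 2 = Pi.single 0 1 + Pi.single 0 1 := by simp [hook]

/-- Value at `3`. [cite: MadrasSlade1993, Definition 1.2.4] -/
@[simp] theorem hook_three (d : ℕ) (s) : hook d s 3 = Pi.single 0 1 + Pi.single 0 1 + twoStepV d s.1 := by simp [hook]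

/-- Value at `4`. [cite: MadrasSlade1993, Definition 1.2.4] -/
@[simp] theorem hook_four (d : ℕ) (s) : hook d s 4 = Pi.single 0 1 + twoStepV d s.1 := by simp [hook]

/-- Value at `5`. [cite: MadrasSlade1993, Definition 1.2.4] -/
@[simp] theorem hook_five (d : ℕ) (s) : hook d s 5 = Pi.single 0 1 + twoStepV d s.1 + twoStepV d s.2 := by simp [hook]

/-- Value at `i ≥ 6`. [cite: MadrasSlade1993, Definition 1.2.4] -/
theorem hook_of_six_le (d : ℕ) (s) {i : ℕ} (hi : 6 ≤ i) :
    hook d s i = Pi.single 0 1 + Pi.single 0 1 + twoStepV d s.1 + twoStepV d s.2 := by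
  have h0 : i ≠ 0 := by omega
  have h1 : i ≠ 1 := by omega
  have h2 : i ≠ 2 := by omega
  have h3 : i ≠ 3 := by omega
  have h4 : i ≠ 4 := by omega
  have h5 : i ≠ 5 := by omega
  simp [hook, h0, h1, h2, h3, h4, h5]

/-- Heights along a hook: `0, 1, 2, 2, 1, 1, 2, 2, …`. [cite: MadrasSlade1993, Definition 1.2.4] -/
theorem hook_apply_zero (d : ℕ) (s) (i : ℕ) :
    hook d s i 0 = if i = 0 then 0 else if i = 1 ∨ i = 4 ∨ i = 5 then 1 else 2 := by
  rcases Nat.lt_or_ge i 6 with hi | hi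
  · interval_cases i <;> simp
  · rw [hook_of_six_le d s hi, if_neg (by omega), if_neg (by omega)]
    simp

/-- A hook with `w ≠ −v` is a six-step self-avoiding walk. [cite: MadrasSlade1993, Definition 1.2.4] -/
theorem hook_mem_saws (d : ℕ) {s} (hs : s ∈ threeStepIndex d) : hook d s ∈ saws (d + 1) 6 := by
  have hab : s.2 ≠ revIdx s.1 := (Finset.mem_filter.1 hs).2
  refine mem_saws.2 ⟨hook_zero d s, fun i hi => ?_, fun i hi => ?_, ?_⟩
  · rw [hook_of_six_le d s hi, hook_of_six_le d s le_rfl]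
  · interval_cases i
    · rw [hook_zero, hook_one, zdGraph_adj_iff]
      exact ⟨0, Or.inl (by simp)⟩
    · rw [hook_one, hook_two]
      exact adj_add_e0 d _
    · rw [hook_two, hook_three]
      exact adj_add_twoStepV d _ _
    · rw [hook_three, hook_four, zdGraph_adj_iff]
      exact ⟨0, Or.inr (by abel)⟩
    · rw [hook_four, hook_five]
      exact adj_add_twoStepV d _ _
    · rw [hook_five, hook_of_six_le d s le_rfl, zdGraph_adj_iff]
      exact ⟨0, Or.inl (by abel)⟩
  · have hne : ∀ i j : ℕ, i ≤ 6 → j ≤ 6 → i < j → hook d s i ≠ hook d s j := by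
      intro i j hi hj hij h
      have hh := congrFun h 0
      rw [hook_apply_zero, hook_apply_zero] at hh
      have key : (i = 1 ∧ j = 4) ∨ (i = 1 ∧ j = 5) ∨ (i = 4 ∧ j = 5) ∨ (i = 2 ∧ j = 3) ∨ (i = 2 ∧ j = 6) ∨
          (i = 3 ∧ j = 6) := by
        split_ifs at hh <;> omega
      rcases key with ⟨rfl, rfl⟩ | ⟨rfl, rfl⟩ | ⟨rfl, rfl⟩ | ⟨rfl, rfl⟩ | ⟨rfl, rfl⟩ | ⟨rfl, rfl⟩
      · rw [hook_one, hook_four] at h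
        exact twoStepV_ne_zero d s.1 (by simpa using h.symm)
      · rw [hook_one, hook_five, add_assoc] at h
        exact twoStepV_add_ne_zero d hab (by simpa using h.symm)
      · rw [hook_four, hook_five] at h
        exact twoStepV_ne_zero d s.2 (by simpa using h.symm)
      · rw [hook_two, hook_three] at h
        exact twoStepV_ne_zero d s.1 (by simpa using h.symm)
      · rw [hook_two, hook_of_six_le d s le_rfl, add_assoc (Pi.single 0 1 + Pi.single 0 1)] at h
        exact twoStepV_add_ne_zero d hab (by simpa using h.symm)
      · rw [hook_three, hook_of_six_le d s le_rfl] at h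
        exact twoStepV_ne_zero d s.2 (by simpa using h.symm)
    intro i hi j hj h
    simp only [Set.mem_setOf_eq] at hi hj
    rcases lt_trichotomy i j with hij | rfl | hij
    · exact absurd h (hne i j hi hj hij)
    · rfl
    · exact absurd h.symm (hne j i hj hi hij)

/-- A hook is a bridge of span two. [cite: MadrasSlade1993, Definition 1.2.4] -/
theorem hook_isBridge (d : ℕ) (s) : IsBridge 6 (hook d s) := by
  intro i h1 h6
  interval_cases i <;> simp [hook_apply_zero]

/-- A hook with `w ≠ −v` is an irreducible bridge of cost four (no renewal time: the profile `1,2,2,1,1,2` dips back to height `1`).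
[cite: DuminilCopinHammond2013, §2.2] -/
theorem hook_mem_filter (d : ℕ) {s} (hs : s ∈ threeStepIndex d) :
    hook d s ∈ (irreducibleBridges (d + 1) 6).filter fun ω => costZd d 6 ω = 4 := by
  refine Finset.mem_filter.2 ⟨mem_irreducibleBridges.2 ⟨mem_bridges.2 ⟨hook_mem_saws d hs, hook_isBridge d s⟩,
    ⟨by norm_num, hook_isBridge d s, fun k hk1 hk2 hren => ?_⟩⟩, ?_⟩
  · obtain ⟨-, hb1, hb2⟩ := hren
    have hk : k = 1 ∨ k = 2 ∨ k = 3 ∨ k = 4 ∨ k = 5 := by omega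
    rcases hk with rfl | rfl | rfl | rfl | rfl
    · have h := (hb2 3 (by norm_num) (by norm_num)).1
      simp [hook_apply_zero] at h
    · have h := (hb2 1 le_rfl (by norm_num)).1
      simp [hook_apply_zero] at h
    · have h := (hb2 1 le_rfl (by norm_num)).1
      simp [hook_apply_zero] at h
    · have h := (hb1 2 (by norm_num) (by norm_num)).2
      simp [hook_apply_zero] at h
    · have h := (hb1 2 (by norm_num) (by norm_num)).2
      simp [hook_apply_zero] at h
  · simp [costZd, hook_apply_zero]

/-- ★ **Every cost-four irreducible bridge of length six is a hook**: the height profile `0, 1, h₂, …, h₅, 2` (`hᵢ ∈ {1,2}`) must be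
`0,1,2,2,1,1,2` — monotone profiles are reducible (`not_irreducible_of_monotone`) and the patterns `1,2,1` / `2,1,2` revisit a site
(`no_up_down_of_mem_saws`, `no_down_up_of_mem_saws`); then the steps are `+e₀,+e₀,v,−e₀,w,+e₀` with `w ≠ −v` (else `ω₅ = ω₁`).
[cite: DuminilCopinHammond2013, §2.2] -/
theorem eq_hook_of_mem (d : ℕ) {ω : ℕ → Site (d + 1)}
    (hω : ω ∈ (irreducibleBridges (d + 1) 6).filter fun ω => costZd d 6 ω = 4) : ∃ s ∈ threeStepIndex d, ω = hook d s := by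
  obtain ⟨hirr, hcost⟩ := Finset.mem_filter.1 hω
  obtain ⟨hbr, hI⟩ := mem_irreducibleBridges.1 hirr
  obtain ⟨hωs, hb⟩ := mem_bridges.1 hbr
  obtain ⟨h0, hend, hadj, hinj⟩ := mem_saws.1 hωs
  have hω1 : ω 1 = Pi.single 0 1 := apply_one_eq_e0_of_mem_bridges d (by norm_num) hbr
  have h00 : ω 0 0 = 0 := by rw [h0]; rfl
  have h1 : ω 1 0 = 1 := by rw [hω1]; simp
  have h6 : ω 6 0 = 2 := by
    simp only [costZd] at hcost
    have := (span_le_and_cost_bound_zd hirr).1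
    have h60 : 0 < ω 6 0 := by have := (hb 6 (by norm_num) le_rfl).1; rwa [h0] at this
    omega
  have hb2 := hb 2 (by norm_num) (by norm_num)
  have hb3 := hb 3 (by norm_num) (by norm_num)
  have hb4 := hb 4 (by norm_num) (by norm_num)
  have hb5 := hb 5 (by norm_num) (by norm_num)
  rw [h0, h6] at hb2 hb3 hb4 hb5
  simp only [Pi.zero_apply] at hb2 hb3 hb4 hb5
  -- the three height-profile tools
  have ud : ∀ i, i + 2 ≤ 6 → ω (i + 1) 0 = ω i 0 + 1 → ω (i + 2) 0 = ω (i + 1) 0 - 1 → False :=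
    fun i hi e1 e2 => no_up_down_of_mem_saws d hωs hi e1 e2
  have du : ∀ i, i + 2 ≤ 6 → ω (i + 1) 0 = ω i 0 - 1 → ω (i + 2) 0 = ω (i + 1) 0 + 1 → False :=
    fun i hi e1 e2 => no_down_up_of_mem_saws d hωs hi e1 e2
  have mono : (∀ i < 6, ω i 0 ≤ ω (i + 1) 0) → False := fun hm => not_irreducible_of_monotone d hirr hm (by rw [h6])
  -- (a) `h₅ = 1`
  have h5 : ω 5 0 = 1 := by
    rcases (show ω 5 0 = 1 ∨ ω 5 0 = 2 by omega) with h | h5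
    · exact h
    exfalso
    rcases (show ω 4 0 = 1 ∨ ω 4 0 = 2 by omega) with h4 | h4
    · rcases (show ω 3 0 = 1 ∨ ω 3 0 = 2 by omega) with h3 | h3
      · rcases (show ω 2 0 = 1 ∨ ω 2 0 = 2 by omega) with h2 | h2
        · exact mono fun i hi => by interval_cases i <;> simp only [Nat.reduceAdd] <;> omega
        · exact ud 1 (by norm_num) (by simp only [Nat.reduceAdd]; omega) (by simp only [Nat.reduceAdd]; omega)
      · exact du 3 (by norm_num) (by simp only [Nat.reduceAdd]; omega) (by simp only [Nat.reduceAdd]; omega)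
    · rcases (show ω 3 0 = 1 ∨ ω 3 0 = 2 by omega) with h3 | h3
      · rcases (show ω 2 0 = 1 ∨ ω 2 0 = 2 by omega) with h2 | h2
        · exact mono fun i hi => by interval_cases i <;> simp only [Nat.reduceAdd] <;> omega
        · exact du 2 (by norm_num) (by simp only [Nat.reduceAdd]; omega) (by simp only [Nat.reduceAdd]; omega)
      · exact mono fun i hi => by interval_cases i <;> simp only [Nat.reduceAdd] <;> omega
  -- (b) `h₄ = 1`
  have h4 : ω 4 0 = 1 := by
    rcases (show ω 4 0 = 1 ∨ ω 4 0 = 2 by omega) with h | h4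
    · exact h
    · exact (du 4 (by norm_num) (by simp only [Nat.reduceAdd]; omega) (by simp only [Nat.reduceAdd]; omega)).elim
  -- (c) `h₃ = 2`
  have h3 : ω 3 0 = 2 := by
    rcases (show ω 3 0 = 1 ∨ ω 3 0 = 2 by omega) with h3 | h
    · exfalso
      rcases (show ω 2 0 = 1 ∨ ω 2 0 = 2 by omega) with h2 | h2
      · exact mono fun i hi => by interval_cases i <;> simp only [Nat.reduceAdd] <;> omega
      · exact ud 1 (by norm_num) (by simp only [Nat.reduceAdd]; omega) (by simp only [Nat.reduceAdd]; omega)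
    · exact h
  -- (d) `h₂ = 2`
  have h2 : ω 2 0 = 2 := by
    rcases (show ω 2 0 = 1 ∨ ω 2 0 = 2 by omega) with h2 | h
    · exact (ud 2 (by norm_num) (by simp only [Nat.reduceAdd]; omega) (by simp only [Nat.reduceAdd]; omega)).elim
    · exact h
  -- the steps
  have e12 : ω 2 = ω 1 + Pi.single 0 1 := eq_add_e0_of_adj d (hadj 1 (by norm_num)) (by rw [h2, h1]; norm_num)
  obtain ⟨a, ha⟩ := exists_twoStepV_of_adj d (hadj 2 (by norm_num)) (by rw [h3, h2])
  have e34 : ω 4 = ω 3 - Pi.single 0 1 := eq_sub_e0_of_adj d (hadj 3 (by norm_num)) (by rw [h4, h3]; norm_num)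
  obtain ⟨b, hb'⟩ := exists_twoStepV_of_adj d (hadj 4 (by norm_num)) (by rw [h5, h4])
  have e56 : ω 6 = ω 5 + Pi.single 0 1 := eq_add_e0_of_adj d (hadj 5 (by norm_num)) (by rw [h6, h5]; norm_num)
  have hω2 : ω 2 = Pi.single 0 1 + Pi.single 0 1 := by rw [e12, hω1]
  have hω3 : ω 3 = Pi.single 0 1 + Pi.single 0 1 + twoStepV d a := by rw [ha, hω2]
  have hω4 : ω 4 = Pi.single 0 1 + twoStepV d a := by rw [e34, hω3]; abel
  have hω5 : ω 5 = Pi.single 0 1 + twoStepV d a + twoStepV d b := by rw [hb', hω4]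
  have hω6 : ω 6 = Pi.single 0 1 + Pi.single 0 1 + twoStepV d a + twoStepV d b := by rw [e56, hω5]; abel
  have hab : b ≠ revIdx a := by
    intro hba
    have h15 : ω 5 = ω 1 := by rw [hω5, hω1, hba, revIdx, twoStepV_not, add_assoc, add_neg_cancel, add_zero]
    have := hinj (show (5 : ℕ) ∈ {i | i ≤ 6} by simp) (show (1 : ℕ) ∈ {i | i ≤ 6} by simp) h15
    omega
  refine ⟨(a, b), Finset.mem_filter.2 ⟨Finset.mem_univ _, hab⟩, funext fun i => ?_⟩
  rcases Nat.lt_or_ge i 6 with hi | hi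
  · interval_cases i
    · rw [h0, hook_zero]
    · rw [hω1, hook_one]
    · rw [hω2, hook_two]
    · rw [hω3, hook_three]
    · rw [hω4, hook_four]
    · rw [hω5, hook_five]
  · rw [hend i hi, hω6, hook_of_six_le d _ hi]

/-- `hook` is injective. [cite: MadrasSlade1993, Definition 1.2.4] -/
theorem hook_injective (d : ℕ) : Function.Injective (hook d) := by
  rintro ⟨a, b⟩ ⟨a', b'⟩ h
  have h3 := congrFun h 3
  rw [hook_three, hook_three, add_right_inj] at h3
  have ha : a = a' := twoStepV_injective d h3
  have h5 := congrFun h 5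
  rw [hook_five, hook_five, ha, add_right_inj] at h5
  have hb : b = b' := twoStepV_injective d h5
  rw [ha, hb]

/-- ★ The cost-four irreducible bridges of length six are exactly the hooks. [cite: MadrasSlade1993, §4.2, eq. (4.2.20)–(4.2.22) (p. 94, 2013 reprint)] -/
theorem filter_costZd_four_six_eq_image (d : ℕ) [DecidableEq (ℕ → Site (d + 1))] :
    ((irreducibleBridges (d + 1) 6).filter fun ω => costZd d 6 ω = 4) = (threeStepIndex d).image (hook d) := by
  ext ω
  constructor
  · intro h
    obtain ⟨s, hs, rfl⟩ := eq_hook_of_mem d h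
    exact Finset.mem_image_of_mem _ hs
  · intro h
    obtain ⟨s, hs, rfl⟩ := Finset.mem_image.1 h
    exact hook_mem_filter d hs

/-- ★ **`N_{4,6} = 2d(2d−1)`** on `ℤ^{d+1}`. [cite: MadrasSlade1993, §4.2, eq. (4.2.20)–(4.2.22) (p. 94, 2013 reprint)] -/
theorem costCoeffZd_four_six (d : ℕ) : costCoeffZd d 4 6 = 2 * d * (2 * d - 1) := by
  classical
  rw [costCoeffZd, filter_costZd_four_six_eq_image, Finset.card_image_of_injective _ (hook_injective d), card_threeStepIndex]

/-! ### Four transverse unit steps summing to zero form a unit square -/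

/-- The sign of a transverse step index. [cite: MadrasSlade1993, Definition 1.2.4] -/
def sgnV {d : ℕ} (a : Fin d × Bool) : ℤ := if a.2 then 1 else -1

/-- `sgnV a = ±1`, so `sgnV a * sgnV a = 1`. [cite: MadrasSlade1993, Definition 1.2.4] -/
theorem sgnV_mul_self {d : ℕ} (a : Fin d × Bool) : sgnV a * sgnV a = 1 := by
  unfold sgnV; split_ifs <;> norm_num

/-- Coordinates of a transverse step: `(σ e_{j+1})_{i+1} = σ [i = j]`. [cite: MadrasSlade1993, Definition 1.2.4] -/
theorem twoStepV_apply_succ (d : ℕ) (a : Fin d × Bool) (j : Fin d) :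
    twoStepV d a j.succ = if j = a.1 then sgnV a else 0 := by
  rw [twoStepV, Pi.single_apply, sgnV]
  simp only [Fin.succ_inj]

/-- `Σ_i (σ_a e_a)_i x_i = σ_a x_a`. [cite: MadrasSlade1993, Definition 1.2.4] -/
theorem sum_twoStepV_mul (d : ℕ) (a : Fin d × Bool) (x : Site (d + 1)) :
    ∑ i, twoStepV d a i * x i = sgnV a * x a.1.succ := by
  rw [Finset.sum_eq_single a.1.succ]
  · rw [twoStepV, Pi.single_eq_same, sgnV]
  · intro i _ hi
    rw [twoStepV, Pi.single_eq_of_ne hi, zero_mul]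
  · intro h
    exact absurd (Finset.mem_univ _) h

/-- The inner product of two transverse steps: `σ_a σ_b [same axis]`. [cite: MadrasSlade1993, Definition 1.2.4] -/
theorem sum_twoStepV_mul_twoStepV (d : ℕ) (a b : Fin d × Bool) :
    ∑ i, twoStepV d a i * twoStepV d b i = if a.1 = b.1 then sgnV a * sgnV b else 0 := by
  rw [sum_twoStepV_mul, twoStepV_apply_succ]
  split_ifs
  · rfl
  · rw [mul_zero]

/-- `⟨v_a, v_a⟩ = 1`. [cite: MadrasSlade1993, Definition 1.2.4] -/
theorem sum_twoStepV_mul_self (d : ℕ) (a : Fin d × Bool) : ∑ i, twoStepV d a i * twoStepV d a i = 1 := by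
  rw [sum_twoStepV_mul_twoStepV, if_pos rfl, sgnV_mul_self]

/-- `⟨v_a, v_b⟩ ≥ −1`, with equality only for `b = −a`; and `⟨v_a, v_b⟩ ≥ 0` when `b ≠ −a`. [cite: MadrasSlade1993, Definition 1.2.4] -/
theorem sum_twoStepV_mul_twoStepV_cases (d : ℕ) (a b : Fin d × Bool) :
    (b ≠ revIdx a → 0 ≤ ∑ i, twoStepV d a i * twoStepV d b i) ∧
      (-1 ≤ ∑ i, twoStepV d a i * twoStepV d b i) ∧
      (∑ i, twoStepV d a i * twoStepV d b i = -1 → b = revIdx a) := by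
  rw [sum_twoStepV_mul_twoStepV]
  rcases a with ⟨ja, sa⟩
  rcases b with ⟨jb, sb⟩
  by_cases hj : ja = jb
  · subst hj
    cases sa <;> cases sb <;> simp [sgnV, revIdx]
  · have hj' : jb ≠ ja := fun h => hj h.symm
    simp [hj, hj', revIdx]

/-- ★ **Four transverse unit steps with no immediate reversal sum to zero only around a unit square**: if `v_b ≠ −v_a`, `v_c ≠ −v_b`,
`v_e ≠ −v_c` and `v_a + v_b + v_c + v_e = 0` then `v_c = −v_a` and `v_e = −v_b` (compare `|v_a + v_b + v_c|² = 3 + 2(⟨a,b⟩ + ⟨b,c⟩ + ⟨a,c⟩)`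
with `|v_e|² = 1`). [cite: MadrasSlade1993, Definition 1.2.4] -/
theorem eq_revIdx_of_sum_four_eq_zero (d : ℕ) {a b c e : Fin d × Bool} (hab : b ≠ revIdx a) (hbc : c ≠ revIdx b)
    (h : twoStepV d a + twoStepV d b + twoStepV d c + twoStepV d e = 0) : c = revIdx a ∧ e = revIdx b := by
  set Va := twoStepV d a with hVa
  set Vb := twoStepV d b with hVb
  set Vc := twoStepV d c with hVc
  set Ve := twoStepV d e with hVe
  have hS : Va + Vb + Vc = -Ve := by rw [← sub_eq_zero, sub_neg_eq_add, h]
  -- `|Va + Vb + Vc|² = |Ve|² = 1`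
  have hN : ∑ i, (Va + Vb + Vc) i * (Va + Vb + Vc) i = 1 := by
    rw [hS]
    simp only [Pi.neg_apply, neg_mul_neg]
    exact sum_twoStepV_mul_self d e
  have hexp : ∑ i, (Va + Vb + Vc) i * (Va + Vb + Vc) i =
      ∑ i, Va i * Va i + ∑ i, Vb i * Vb i + ∑ i, Vc i * Vc i +
        2 * ∑ i, Va i * Vb i + 2 * ∑ i, Vb i * Vc i + 2 * ∑ i, Va i * Vc i := by
    simp only [Pi.add_apply, Finset.mul_sum, ← Finset.sum_add_distrib]
    exact Finset.sum_congr rfl fun i _ => by ring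
  rw [hexp, sum_twoStepV_mul_self, sum_twoStepV_mul_self, sum_twoStepV_mul_self] at hN
  obtain ⟨hab0, -, -⟩ := sum_twoStepV_mul_twoStepV_cases d a b
  obtain ⟨hbc0, -, -⟩ := sum_twoStepV_mul_twoStepV_cases d b c
  obtain ⟨-, hac1, hac⟩ := sum_twoStepV_mul_twoStepV_cases d a c
  have hab0 := hab0 hab
  have hbc0 := hbc0 hbc
  have hca : c = revIdx a := hac (by linarith)
  refine ⟨hca, ?_⟩
  have hac0 : Va + Vc = 0 := by rw [hVc, hca, revIdx, twoStepV_not, hVa, add_neg_cancel]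
  have hbe : Vb + Ve = 0 := by
    have : Va + Vb + Vc + Ve = (Va + Vc) + (Vb + Ve) := by abel
    rw [this, hac0, zero_add] at h
    exact h
  exact twoStepV_add_eq_zero d hbe

/-! ### The cost-four irreducible bridges of length five: `+e₀` and four transverse steps forming a self-avoiding walk -/

/-- `−(−v) = v`. [cite: MadrasSlade1993, Definition 1.2.4] -/
@[simp] theorem revIdx_revIdx {d : ℕ} (a : Fin d × Bool) : revIdx (revIdx a) = a := by
  rcases a with ⟨j, b⟩; simp [revIdx]

/-- `−v ≠ v`. [cite: MadrasSlade1993, Definition 1.2.4] -/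
theorem revIdx_ne_self {d : ℕ} (a : Fin d × Bool) : revIdx a ≠ a := by
  rcases a with ⟨j, b⟩; cases b <;> simp [revIdx]

/-- `revIdx` is injective. [cite: MadrasSlade1993, Definition 1.2.4] -/
theorem revIdx_inj {d : ℕ} {a b : Fin d × Bool} (h : revIdx a = revIdx b) : a = b := by
  rw [← revIdx_revIdx a, h, revIdx_revIdx]

/-- `#{b : b ≠ x} = 2d − 1`. [cite: MadrasSlade1993, §1.2] -/
theorem card_filter_ne_idx (d : ℕ) (x : Fin d × Bool) : (Finset.univ.filter fun b : Fin d × Bool => b ≠ x).card = 2 * d - 1 := by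
  classical
  have hA : Fintype.card (Fin d × Bool) = 2 * d := by rw [Fintype.card_prod, Fintype.card_fin, Fintype.card_bool, mul_comm]
  rw [Finset.filter_ne' Finset.univ x, Finset.card_erase_of_mem (Finset.mem_univ x), Finset.card_univ, hA]

/-- `#{b : b ≠ x, b ≠ y} = 2d − 2` for `x ≠ y`. [cite: MadrasSlade1993, §1.2] -/
theorem card_filter_ne_ne_idx (d : ℕ) {x y : Fin d × Bool} (hxy : x ≠ y) :
    (Finset.univ.filter fun b : Fin d × Bool => b ≠ x ∧ b ≠ y).card = 2 * d - 2 := by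
  classical
  have hA : Fintype.card (Fin d × Bool) = 2 * d := by rw [Fintype.card_prod, Fintype.card_fin, Fintype.card_bool, mul_comm]
  have : (Finset.univ.filter fun b : Fin d × Bool => b ≠ x ∧ b ≠ y) = Finset.univ \ {x, y} := by
    ext b; simp [not_or]
  rw [this, Finset.card_sdiff_of_subset (Finset.subset_univ _), Finset.card_univ, hA, Finset.card_pair hxy]

/-- Quadruples of transverse steps with no immediate reversal. [cite: MadrasSlade1993, §4.2, eq. (4.2.20)–(4.2.22) (p. 94, 2013 reprint)] -/
def nonrevFour (d : ℕ) : Finset ((Fin d × Bool) × (Fin d × Bool) × (Fin d × Bool) × (Fin d × Bool)) :=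
  Finset.univ.filter fun s => s.2.1 ≠ revIdx s.1 ∧ s.2.2.1 ≠ revIdx s.2.1 ∧ s.2.2.2 ≠ revIdx s.2.2.1

/-- The unit squares `(v, w, −v, −w)`, `w ≠ ±v`. [cite: MadrasSlade1993, §4.2, eq. (4.2.20)–(4.2.22) (p. 94, 2013 reprint)] -/
def squareFour (d : ℕ) : Finset ((Fin d × Bool) × (Fin d × Bool) × (Fin d × Bool) × (Fin d × Bool)) :=
  Finset.univ.filter fun s => s.2.1 ≠ revIdx s.1 ∧ s.2.1 ≠ s.1 ∧ s.2.2.1 = revIdx s.1 ∧ s.2.2.2 = revIdx s.2.1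

/-- The index set of the cost-four irreducible bridges of length five: no immediate reversal and not a unit square.
[cite: MadrasSlade1993, §4.2, eq. (4.2.20)–(4.2.22) (p. 94, 2013 reprint)] -/
def fiveStepIndex (d : ℕ) : Finset ((Fin d × Bool) × (Fin d × Bool) × (Fin d × Bool) × (Fin d × Bool)) :=
  Finset.univ.filter fun s => s.2.1 ≠ revIdx s.1 ∧ s.2.2.1 ≠ revIdx s.2.1 ∧ s.2.2.2 ≠ revIdx s.2.2.1 ∧
    ¬ (s.2.2.1 = revIdx s.1 ∧ s.2.2.2 = revIdx s.2.1)

/-- `#nonrevFour = 2d(2d−1)³` (the fibre over a non-reversing triple has `2d − 1` elements). [cite: MadrasSlade1993, §1.2] -/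
theorem card_nonrevFour (d : ℕ) : (nonrevFour d).card = 2 * d * (2 * d - 1) ^ 3 := by
  classical
  have heq : nonrevFour d = (fourStepIndex d).biUnion fun t =>
      (Finset.univ.filter fun e : Fin d × Bool => e ≠ revIdx t.2.2).image fun e => (t.1, t.2.1, t.2.2, e) := by
    ext ⟨a, b, c, e⟩
    simp only [nonrevFour, fourStepIndex, Finset.mem_filter, Finset.mem_univ, true_and, Finset.mem_biUnion, Finset.mem_image,
      Prod.mk.injEq]
    constructor
    · rintro ⟨h1, h2, h3⟩
      exact ⟨(a, b, c), ⟨h1, h2⟩, e, h3, rfl, rfl, rfl, rfl⟩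
    · rintro ⟨t, ⟨h1, h2⟩, e', h3, rfl, rfl, rfl, rfl⟩
      exact ⟨h1, h2, h3⟩
  rw [heq, Finset.card_biUnion]
  · have : ∀ t ∈ fourStepIndex d, ((Finset.univ.filter fun e : Fin d × Bool => e ≠ revIdx t.2.2).image
        fun e => (t.1, t.2.1, t.2.2, e)).card = 2 * d - 1 := by
      intro t _
      rw [Finset.card_image_of_injective _ (fun e e' h => by simpa using h), card_filter_ne_idx]
    rw [Finset.sum_congr rfl this, Finset.sum_const, card_fourStepIndex, smul_eq_mul]
    ring
  · intro t _ t' _ htt'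
    simp only [Function.onFun]
    rw [Finset.disjoint_left]
    intro x hx hx'
    obtain ⟨e, -, rfl⟩ := Finset.mem_image.1 hx
    obtain ⟨e', -, h⟩ := Finset.mem_image.1 hx'
    simp only [Prod.mk.injEq] at h
    obtain ⟨h1, h2, h3, -⟩ := h
    exact htt' (Prod.ext h1.symm (Prod.ext h2.symm h3.symm))

/-- `#squareFour = 2d(2d−2)`. [cite: MadrasSlade1993, §1.2] -/
theorem card_squareFour (d : ℕ) : (squareFour d).card = 2 * d * (2 * d - 2) := by
  classical
  have hA : Fintype.card (Fin d × Bool) = 2 * d := by rw [Fintype.card_prod, Fintype.card_fin, Fintype.card_bool, mul_comm]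
  have heq : squareFour d = (Finset.univ : Finset (Fin d × Bool)).biUnion fun a =>
      (Finset.univ.filter fun b : Fin d × Bool => b ≠ revIdx a ∧ b ≠ a).image fun b => (a, b, revIdx a, revIdx b) := by
    ext ⟨a, b, c, e⟩
    simp only [squareFour, Finset.mem_filter, Finset.mem_univ, true_and, Finset.mem_biUnion, Finset.mem_image, Prod.mk.injEq]
    constructor
    · rintro ⟨h1, h2, h3, h4⟩
      exact ⟨a, b, ⟨h1, h2⟩, rfl, rfl, h3.symm, h4.symm⟩
    · rintro ⟨a', b', ⟨h1, h2⟩, rfl, rfl, h3, h4⟩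
      exact ⟨h1, h2, h3.symm, h4.symm⟩
  rw [heq, Finset.card_biUnion]
  · have : ∀ a ∈ (Finset.univ : Finset (Fin d × Bool)), ((Finset.univ.filter fun b : Fin d × Bool => b ≠ revIdx a ∧ b ≠ a).image
        fun b => (a, b, revIdx a, revIdx b)).card = 2 * d - 2 := by
      intro a _
      rw [Finset.card_image_of_injective _ (fun b b' h => by simp only [Prod.mk.injEq] at h; exact h.2.1),
        card_filter_ne_ne_idx d (revIdx_ne_self a)]
    rw [Finset.sum_congr rfl this, Finset.sum_const, Finset.card_univ, hA, smul_eq_mul]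
  · intro a _ a' _ haa'
    simp only [Function.onFun]
    rw [Finset.disjoint_left]
    intro x hx hx'
    obtain ⟨b, -, rfl⟩ := Finset.mem_image.1 hx
    obtain ⟨b', -, h⟩ := Finset.mem_image.1 hx'
    simp only [Prod.mk.injEq] at h
    exact haa' h.1.symm

/-- The unit squares have no immediate reversal. [cite: MadrasSlade1993, §1.2] -/
theorem squareFour_subset_nonrevFour (d : ℕ) : squareFour d ⊆ nonrevFour d := by
  rintro ⟨a, b, c, e⟩ hs
  simp only [squareFour, nonrevFour, Finset.mem_filter, Finset.mem_univ, true_and] at hs ⊢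
  obtain ⟨h1, h2, rfl, rfl⟩ := hs
  refine ⟨h1, fun h => h2 (revIdx_inj h).symm, fun h => ?_⟩
  rw [revIdx_revIdx] at h
  exact h1 (by rw [← h, revIdx_revIdx])

/-- `fiveStepIndex = nonrevFour ∖ squareFour`. [cite: MadrasSlade1993, §4.2, eq. (4.2.20)–(4.2.22) (p. 94, 2013 reprint)] -/
theorem fiveStepIndex_eq_sdiff (d : ℕ) : fiveStepIndex d = nonrevFour d \ squareFour d := by
  ext ⟨a, b, c, e⟩
  simp only [fiveStepIndex, nonrevFour, squareFour, Finset.mem_filter, Finset.mem_univ, true_and, Finset.mem_sdiff, not_and]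
  constructor
  · rintro ⟨h1, h2, h3, h4⟩
    exact ⟨⟨h1, h2, h3⟩, fun _ _ hc he => h4 hc he⟩
  · rintro ⟨⟨h1, h2, h3⟩, h4⟩
    refine ⟨h1, h2, h3, fun hc he => h4 h1 (fun hba => ?_) hc he⟩
    exact h2 (by rw [hc, hba])

/-- ★ `#fiveStepIndex = 2d(2d−1)³ − 2d(2d−2)` (the number of four-step self-avoiding walks of `ℤ^d`: non-reversing words minus the
unit squares). [cite: MadrasSlade1993, §1.2] -/
theorem card_fiveStepIndex (d : ℕ) : (fiveStepIndex d).card = 2 * d * (2 * d - 1) ^ 3 - 2 * d * (2 * d - 2) := by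
  rw [fiveStepIndex_eq_sdiff, Finset.card_sdiff_of_subset (squareFour_subset_nonrevFour d), card_nonrevFour, card_squareFour]

/-- The five-step walk `(0, e₀, e₀+v₁, …, e₀+v₁+v₂+v₃+v₄)`. [cite: MadrasSlade1993, Definition 1.2.4] -/
def fiveStep (d : ℕ) (s : (Fin d × Bool) × (Fin d × Bool) × (Fin d × Bool) × (Fin d × Bool)) : ℕ → Site (d + 1) := fun i =>
  if i = 0 then 0 else if i = 1 then Pi.single 0 1 else if i = 2 then Pi.single 0 1 + twoStepV d s.1
  else if i = 3 then Pi.single 0 1 + twoStepV d s.1 + twoStepV d s.2.1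
  else if i = 4 then Pi.single 0 1 + twoStepV d s.1 + twoStepV d s.2.1 + twoStepV d s.2.2.1
  else Pi.single 0 1 + twoStepV d s.1 + twoStepV d s.2.1 + twoStepV d s.2.2.1 + twoStepV d s.2.2.2

/-- Value at `0`. [cite: MadrasSlade1993, Definition 1.2.4] -/
@[simp] theorem fiveStep_zero (d : ℕ) (s) : fiveStep d s 0 = 0 := by simp [fiveStep]

/-- Value at `1`. [cite: MadrasSlade1993, Definition 1.2.4] -/
@[simp] theorem fiveStep_one (d : ℕ) (s) : fiveStep d s 1 = Pi.single 0 1 := by simp [fiveStep]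

/-- Value at `2`. [cite: MadrasSlade1993, Definition 1.2.4] -/
@[simp] theorem fiveStep_two (d : ℕ) (s) : fiveStep d s 2 = Pi.single 0 1 + twoStepV d s.1 := by simp [fiveStep]

/-- Value at `3`. [cite: MadrasSlade1993, Definition 1.2.4] -/
@[simp] theorem fiveStep_three (d : ℕ) (s) : fiveStep d s 3 = Pi.single 0 1 + twoStepV d s.1 + twoStepV d s.2.1 := by
  simp [fiveStep]

/-- Value at `4`. [cite: MadrasSlade1993, Definition 1.2.4] -/
@[simp] theorem fiveStep_four (d : ℕ) (s) :
    fiveStep d s 4 = Pi.single 0 1 + twoStepV d s.1 + twoStepV d s.2.1 + twoStepV d s.2.2.1 := by simp [fiveStep]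

/-- Value at `i ≥ 5`. [cite: MadrasSlade1993, Definition 1.2.4] -/
theorem fiveStep_of_five_le (d : ℕ) (s) {i : ℕ} (hi : 5 ≤ i) :
    fiveStep d s i = Pi.single 0 1 + twoStepV d s.1 + twoStepV d s.2.1 + twoStepV d s.2.2.1 + twoStepV d s.2.2.2 := by
  have h0 : i ≠ 0 := by omega
  have h1 : i ≠ 1 := by omega
  have h2 : i ≠ 2 := by omega
  have h3 : i ≠ 3 := by omega
  have h4 : i ≠ 4 := by omega
  simp [fiveStep, h0, h1, h2, h3, h4]

/-- Heights along `fiveStep`: `0, 1, 1, 1, 1, 1, …`. [cite: MadrasSlade1993, Definition 1.2.4] -/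
theorem fiveStep_apply_zero (d : ℕ) (s) (i : ℕ) : fiveStep d s i 0 = if i = 0 then 0 else 1 := by
  rcases Nat.lt_or_ge i 5 with hi | hi
  · interval_cases i <;> simp
  · rw [fiveStep_of_five_le d s hi, if_neg (by omega)]
    simp

/-- `fiveStep s`, `s ∈ fiveStepIndex`, is a five-step self-avoiding walk. [cite: MadrasSlade1993, Definition 1.2.4] -/
theorem fiveStep_mem_saws (d : ℕ) {s} (hs : s ∈ fiveStepIndex d) : fiveStep d s ∈ saws (d + 1) 5 := by
  obtain ⟨h12, h23, h34, hsq⟩ := (Finset.mem_filter.1 hs).2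
  refine mem_saws.2 ⟨fiveStep_zero d s, fun i hi => ?_, fun i hi => ?_, ?_⟩
  · rw [fiveStep_of_five_le d s hi, fiveStep_of_five_le d s le_rfl]
  · interval_cases i
    · rw [fiveStep_zero, fiveStep_one, zdGraph_adj_iff]
      exact ⟨0, Or.inl (by simp)⟩
    · rw [fiveStep_one, fiveStep_two]
      exact adj_add_twoStepV d _ _
    · rw [fiveStep_two, fiveStep_three]
      exact adj_add_twoStepV d _ _
    · rw [fiveStep_three, fiveStep_four]
      exact adj_add_twoStepV d _ _
    · rw [fiveStep_four, fiveStep_of_five_le d s le_rfl]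
      exact adj_add_twoStepV d _ _
  · have hne : ∀ i j : ℕ, i ≤ 5 → j ≤ 5 → i < j → fiveStep d s i ≠ fiveStep d s j := by
      intro i j hi hj hij h
      have hh := congrFun h 0
      rw [fiveStep_apply_zero, fiveStep_apply_zero] at hh
      have hi0 : i ≠ 0 := by rintro rfl; simp [show j ≠ 0 by omega] at hh
      have key : (i = 1 ∧ j = 2) ∨ (i = 1 ∧ j = 3) ∨ (i = 1 ∧ j = 4) ∨ (i = 1 ∧ j = 5) ∨ (i = 2 ∧ j = 3) ∨ (i = 2 ∧ j = 4) ∨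
          (i = 2 ∧ j = 5) ∨ (i = 3 ∧ j = 4) ∨ (i = 3 ∧ j = 5) ∨ (i = 4 ∧ j = 5) := by omega
      rcases key with ⟨rfl, rfl⟩ | ⟨rfl, rfl⟩ | ⟨rfl, rfl⟩ | ⟨rfl, rfl⟩ | ⟨rfl, rfl⟩ | ⟨rfl, rfl⟩ | ⟨rfl, rfl⟩ | ⟨rfl, rfl⟩ |
          ⟨rfl, rfl⟩ | ⟨rfl, rfl⟩
      · rw [fiveStep_one, fiveStep_two] at h
        exact twoStepV_ne_zero d s.1 (by simpa using h.symm)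
      · rw [fiveStep_one, fiveStep_three, add_assoc] at h
        exact twoStepV_add_ne_zero d h12 (by simpa using h.symm)
      · rw [fiveStep_one, fiveStep_four, add_assoc, add_assoc] at h
        have h' : twoStepV d s.1 + (twoStepV d s.2.1 + twoStepV d s.2.2.1) = 0 := by simpa using h.symm
        exact twoStepV_add_add_ne_zero d s.1 s.2.1 s.2.2.1 (by rw [add_assoc]; exact h')
      · rw [fiveStep_one, fiveStep_of_five_le d s le_rfl, add_assoc, add_assoc, add_assoc] at h
        have h' : twoStepV d s.1 + (twoStepV d s.2.1 + (twoStepV d s.2.2.1 + twoStepV d s.2.2.2)) = 0 := by simpa using h.symm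
        exact hsq (eq_revIdx_of_sum_four_eq_zero d h12 h23 (by rw [add_assoc, add_assoc]; exact h'))
      · rw [fiveStep_two, fiveStep_three] at h
        exact twoStepV_ne_zero d s.2.1 (by simpa using h.symm)
      · rw [fiveStep_two, fiveStep_four, add_assoc (Pi.single 0 1 + twoStepV d s.1)] at h
        exact twoStepV_add_ne_zero d h23 (by simpa using h.symm)
      · rw [fiveStep_two, fiveStep_of_five_le d s le_rfl, add_assoc (Pi.single 0 1 + twoStepV d s.1),
          add_assoc (Pi.single 0 1 + twoStepV d s.1)] at h
        have h' : twoStepV d s.2.1 + twoStepV d s.2.2.1 + twoStepV d s.2.2.2 = 0 := by simpa using h.symm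
        exact twoStepV_add_add_ne_zero d s.2.1 s.2.2.1 s.2.2.2 h'
      · rw [fiveStep_three, fiveStep_four] at h
        exact twoStepV_ne_zero d s.2.2.1 (by simpa using h.symm)
      · rw [fiveStep_three, fiveStep_of_five_le d s le_rfl, add_assoc (Pi.single 0 1 + twoStepV d s.1 + twoStepV d s.2.1)] at h
        exact twoStepV_add_ne_zero d h34 (by simpa using h.symm)
      · rw [fiveStep_four, fiveStep_of_five_le d s le_rfl] at h
        exact twoStepV_ne_zero d s.2.2.2 (by simpa using h.symm)
    intro i hi j hj h
    simp only [Set.mem_setOf_eq] at hi hj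
    rcases lt_trichotomy i j with hij | rfl | hij
    · exact absurd h (hne i j hi hj hij)
    · rfl
    · exact absurd h.symm (hne j i hj hi hij)

/-- `fiveStep s` is an irreducible bridge of cost four. [cite: DuminilCopinHammond2013, §2.2] -/
theorem fiveStep_mem_filter (d : ℕ) {s} (hs : s ∈ fiveStepIndex d) :
    fiveStep d s ∈ (irreducibleBridges (d + 1) 5).filter fun ω => costZd d 5 ω = 4 := by
  have hb : IsBridge 5 (fiveStep d s) := by
    intro i h1 h2
    rw [fiveStep_apply_zero, fiveStep_apply_zero, fiveStep_apply_zero, if_pos rfl, if_neg (by omega), if_neg (by omega)]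
    exact ⟨zero_lt_one, le_rfl⟩
  refine Finset.mem_filter.2 ⟨mem_irreducibleBridges.2 ⟨mem_bridges.2 ⟨fiveStep_mem_saws d hs, hb⟩,
    ⟨by norm_num, hb, fun k hk1 hk2 hren => ?_⟩⟩, ?_⟩
  · have h := (hren.2.2 1 le_rfl (by omega)).1
    simp only [add_zero, fiveStep_apply_zero] at h
    have hk0 : k ≠ 0 := by omega
    have hk1' : k + 1 ≠ 0 := by omega
    rw [if_neg hk0, if_neg hk1'] at h
    exact lt_irrefl _ h
  · simp [costZd, fiveStep_apply_zero]

/-- ★ **Every cost-four irreducible bridge of length five is a `fiveStep`** (span one, so four transverse steps; self-avoidance gives no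
immediate reversal and, by the four-vector lemma, excludes the unit square). [cite: MadrasSlade1993, Definition 1.2.4] -/
theorem eq_fiveStep_of_mem (d : ℕ) {ω : ℕ → Site (d + 1)}
    (hω : ω ∈ (irreducibleBridges (d + 1) 5).filter fun ω => costZd d 5 ω = 4) : ∃ s ∈ fiveStepIndex d, ω = fiveStep d s := by
  obtain ⟨hirr, hcost⟩ := Finset.mem_filter.1 hω
  obtain ⟨hbr, -⟩ := mem_irreducibleBridges.1 hirr
  obtain ⟨hωs, hb⟩ := mem_bridges.1 hbr
  obtain ⟨h0, hend, hadj, hinj⟩ := mem_saws.1 hωs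
  have hω1 : ω 1 = Pi.single 0 1 := apply_one_eq_e0_of_mem_bridges d (by norm_num) hbr
  have h5eq : ω 5 0 = 1 := by
    have hc : costZd d 5 ω = 4 := hcost
    simp only [costZd] at hc
    have := (span_le_and_cost_bound_zd hirr).1
    have h50 : 0 < ω 5 0 := by have := (hb 5 (by norm_num) le_rfl).1; rwa [h0] at this
    omega
  have h1eq : ω 1 0 = 1 := by rw [hω1]; simp
  have hieq : ∀ i, 1 ≤ i → i ≤ 5 → ω i 0 = 1 := by
    intro i hi1 hi5
    have h := hb i hi1 hi5
    rw [h0, h5eq] at h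
    simp only [Pi.zero_apply] at h
    omega
  obtain ⟨a, ha⟩ := exists_twoStepV_of_adj d (hadj 1 (by norm_num)) (by rw [hieq 2 (by norm_num) (by norm_num), h1eq])
  obtain ⟨b, hb'⟩ := exists_twoStepV_of_adj d (hadj 2 (by norm_num))
    (by rw [hieq 3 (by norm_num) (by norm_num), hieq 2 (by norm_num) (by norm_num)])
  obtain ⟨c, hc'⟩ := exists_twoStepV_of_adj d (hadj 3 (by norm_num))
    (by rw [hieq 4 (by norm_num) (by norm_num), hieq 3 (by norm_num) (by norm_num)])
  obtain ⟨e, he'⟩ := exists_twoStepV_of_adj d (hadj 4 (by norm_num))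
    (by rw [hieq 5 (by norm_num) le_rfl, hieq 4 (by norm_num) (by norm_num)])
  have hmem : ∀ i : ℕ, i ≤ 5 → i ∈ {j : ℕ | j ≤ 5} := fun i hi => hi
  have hab : b ≠ revIdx a := by
    intro hba
    have h13 : ω 3 = ω 1 := by rw [hb', ha, hba, revIdx, twoStepV_not, add_assoc, add_neg_cancel, add_zero]
    have := hinj (hmem 3 (by norm_num)) (hmem 1 (by norm_num)) h13
    omega
  have hbc : c ≠ revIdx b := by
    intro hcb
    have h24 : ω 4 = ω 2 := by rw [hc', hb', hcb, revIdx, twoStepV_not, add_assoc, add_neg_cancel, add_zero]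
    have := hinj (hmem 4 (by norm_num)) (hmem 2 (by norm_num)) h24
    omega
  have hce : e ≠ revIdx c := by
    intro hec
    have h35 : ω 5 = ω 3 := by rw [he', hc', hec, revIdx, twoStepV_not, add_assoc, add_neg_cancel, add_zero]
    have := hinj (hmem 5 le_rfl) (hmem 3 (by norm_num)) h35
    omega
  have hsq : ¬ (c = revIdx a ∧ e = revIdx b) := by
    rintro ⟨hca, heb⟩
    have h15 : ω 5 = ω 1 := by
      rw [he', hc', hb', ha, hca, heb, revIdx, revIdx, twoStepV_not, twoStepV_not]
      abel
    have := hinj (hmem 5 le_rfl) (hmem 1 (by norm_num)) h15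
    omega
  refine ⟨(a, b, c, e), Finset.mem_filter.2 ⟨Finset.mem_univ _, hab, hbc, hce, hsq⟩, funext fun i => ?_⟩
  rcases Nat.lt_or_ge i 5 with hi5 | hi5
  · interval_cases i
    · rw [h0, fiveStep_zero]
    · rw [hω1, fiveStep_one]
    · rw [ha, hω1, fiveStep_two]
    · rw [hb', ha, hω1, fiveStep_three]
    · rw [hc', hb', ha, hω1, fiveStep_four]
  · rw [hend i hi5, he', hc', hb', ha, hω1, fiveStep_of_five_le d _ hi5]

/-- `fiveStep` is injective. [cite: MadrasSlade1993, Definition 1.2.4] -/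
theorem fiveStep_injective (d : ℕ) : Function.Injective (fiveStep d) := by
  rintro ⟨a, b, c, e⟩ ⟨a', b', c', e'⟩ h
  have h2 := congrFun h 2
  rw [fiveStep_two, fiveStep_two, add_right_inj] at h2
  have ha : a = a' := twoStepV_injective d h2
  have h3 := congrFun h 3
  rw [fiveStep_three, fiveStep_three, ha, add_right_inj] at h3
  have hb : b = b' := twoStepV_injective d h3
  have h4 := congrFun h 4
  rw [fiveStep_four, fiveStep_four, ha, hb, add_right_inj] at h4
  have hc : c = c' := twoStepV_injective d h4
  have h5 := congrFun h 5
  rw [fiveStep_of_five_le d _ le_rfl, fiveStep_of_five_le d _ le_rfl, ha, hb, hc, add_right_inj] at h5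
  have he : e = e' := twoStepV_injective d h5
  rw [ha, hb, hc, he]

/-- ★ The cost-four irreducible bridges of length five are exactly the `fiveStep`s. [cite: MadrasSlade1993, §4.2, eq. (4.2.20)–(4.2.22) (p. 94, 2013 reprint)] -/
theorem filter_costZd_four_five_eq_image (d : ℕ) [DecidableEq (ℕ → Site (d + 1))] :
    ((irreducibleBridges (d + 1) 5).filter fun ω => costZd d 5 ω = 4) = (fiveStepIndex d).image (fiveStep d) := by
  ext ω
  constructor
  · intro h
    obtain ⟨s, hs, rfl⟩ := eq_fiveStep_of_mem d h
    exact Finset.mem_image_of_mem _ hs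
  · intro h
    obtain ⟨s, hs, rfl⟩ := Finset.mem_image.1 h
    exact fiveStep_mem_filter d hs

/-- ★ **`N_{4,5} = 2d(2d−1)³ − 2d(2d−2)`** on `ℤ^{d+1}` (the number of four-step self-avoiding walks of `ℤ^d`).
[cite: MadrasSlade1993, §4.2, eq. (4.2.20)–(4.2.22) (p. 94, 2013 reprint)] -/
theorem costCoeffZd_four_five (d : ℕ) : costCoeffZd d 4 5 = 2 * d * (2 * d - 1) ^ 3 - 2 * d * (2 * d - 2) := by
  classical
  rw [costCoeffZd, filter_costZd_four_five_eq_image, Finset.card_image_of_injective _ (fiveStep_injective d), card_fiveStepIndex]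

/-! ### The cost-four census, the moments, and `c^{(d)}_4` -/

/-- ★ **`N_{4,n}`** on `ℤ^{d+1}`: `2d(2d−1)³ − 2d(2d−2)` at `n = 5`, `2d(2d−1)` at `n = 6`, zero otherwise.
[cite: MadrasSlade1993, §4.2, eq. (4.2.20)–(4.2.22) (p. 94, 2013 reprint)] -/
theorem costCoeffZd_four (d n : ℕ) : costCoeffZd d 4 n =
    if n = 5 then 2 * d * (2 * d - 1) ^ 3 - 2 * d * (2 * d - 2) else if n = 6 then 2 * d * (2 * d - 1) else 0 := by
  by_cases h5 : n = 5
  · subst h5; rw [if_pos rfl, costCoeffZd_four_five]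
  rw [if_neg h5]
  by_cases h6 : n = 6
  · subst h6; rw [if_pos rfl, costCoeffZd_four_six]
  rw [if_neg h6]
  rcases Nat.lt_or_ge n 8 with h | h
  · rcases Nat.lt_or_ge n 5 with h' | h'
    · exact costCoeffZd_eq_zero_of_le (by omega)
    · obtain rfl : n = 7 := by omega
      exact costCoeffZd_four_seven d
  · exact costCoeffZd_eq_zero_of_lt (by omega)

/-- `N_{4,5} + 2d(2d−2) = 2d(2d−1)³` (subtraction-free form). [cite: MadrasSlade1993, §4.2, eq. (4.2.20)–(4.2.22) (p. 94, 2013 reprint)] -/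
theorem costCoeffZd_four_five_add (d : ℕ) : costCoeffZd d 4 5 + 2 * d * (2 * d - 2) = 2 * d * (2 * d - 1) ^ 3 := by
  classical
  rw [costCoeffZd, filter_costZd_four_five_eq_image, Finset.card_image_of_injective _ (fiveStep_injective d),
    fiveStepIndex_eq_sdiff, ← card_squareFour, ← card_nonrevFour]
  exact Finset.card_sdiff_add_card_eq_card (squareFour_subset_nonrevFour d)

/-- `pT₁ = 0` (the cost-one bridges have two steps). [cite: JansevanRensburgWhittington2013, §3.2 Theorem 8 (arXiv v4 p. 11)] -/
theorem pT_one (d : ℕ) : CostSeries.pT (costCoeffZd d) 1 = 0 := by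
  rw [CostSeries.pT, show 2 * 1 + 2 = 4 from rfl]
  simp only [Finset.sum_range_succ, Finset.sum_range_zero, costCoeffZd_one_two,
    costCoeffZd_one_of_ne_two d (show (0:ℕ) ≠ 2 by norm_num), costCoeffZd_one_of_ne_two d (show (1:ℕ) ≠ 2 by norm_num),
    costCoeffZd_one_of_ne_two d (show (3:ℕ) ≠ 2 by norm_num), Nat.choose]
  push_cast; ring

/-- `pH₂ = 3 · 2d(2d−1)`. [cite: JansevanRensburgWhittington2013, §3.2 Theorem 8 (arXiv v4 p. 11)] -/
theorem pH_two (d : ℕ) : CostSeries.pH (costCoeffZd d) 2 = 3 * (2 * d * (2 * d - 1)) := by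
  rw [CostSeries.pH, show 2 * 2 + 2 = 6 from rfl]
  simp only [Finset.sum_range_succ, Finset.sum_range_zero, costCoeffZd_two, Nat.choose]
  rcases Nat.eq_zero_or_pos d with rfl | hd
  · simp
  · obtain ⟨e, rfl⟩ : ∃ e, d = e + 1 := ⟨d - 1, by omega⟩
    simp only [show 2 * (e + 1) - 1 = 2 * e + 1 by omega]
    push_cast; ring

/-- `pD₃ = 4 · 2d(2d−1)²`. [cite: JansevanRensburgWhittington2013, §3.2 Theorem 8 (arXiv v4 p. 11)] -/
theorem pD_three (d : ℕ) : CostSeries.pD (costCoeffZd d) 3 = 4 * (2 * d * (2 * d - 1) ^ 2) := by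
  rw [CostSeries.pD, show 2 * 3 + 2 = 8 from rfl]
  simp only [Finset.sum_range_succ, Finset.sum_range_zero, costCoeffZd_three]
  rcases Nat.eq_zero_or_pos d with rfl | hd
  · simp
  · obtain ⟨e, rfl⟩ : ∃ e, d = e + 1 := ⟨d - 1, by omega⟩
    simp only [show 2 * (e + 1) - 1 = 2 * e + 1 by omega]
    push_cast; ring

/-- ★ `pS₄ = N_{4,5} + N_{4,6} = 16d⁴ − 24d³ + 12d²`. [cite: JansevanRensburgWhittington2013, §3.2 Theorem 8 (arXiv v4 p. 11)] -/
theorem pS_four (d : ℕ) : CostSeries.pS (costCoeffZd d) 4 = 16 * d ^ 4 - 24 * d ^ 3 + 12 * d ^ 2 := by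
  have h45 := costCoeffZd_four_five_add d
  rw [CostSeries.pS, show 2 * 4 + 2 = 10 from rfl]
  simp only [Finset.sum_range_succ, Finset.sum_range_zero, costCoeffZd_four_six, costCoeffZd_four_seven,
    costCoeffZd_eq_zero_of_le (show 0 ≤ 4 by norm_num), costCoeffZd_eq_zero_of_le (show 1 ≤ 4 by norm_num),
    costCoeffZd_eq_zero_of_le (show 2 ≤ 4 by norm_num), costCoeffZd_eq_zero_of_le (show 3 ≤ 4 by norm_num),
    costCoeffZd_eq_zero_of_le (show 4 ≤ 4 from le_rfl),
    costCoeffZd_eq_zero_of_lt (show 3 * 4 + 2 < 2 * 8 by norm_num), costCoeffZd_eq_zero_of_lt (show 3 * 4 + 2 < 2 * 9 by norm_num)]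
  rcases Nat.eq_zero_or_pos d with rfl | hd
  · simp at h45 ⊢
    have : costCoeffZd 0 4 5 = 0 := by simpa using h45
    simp [this]
  · obtain ⟨e, rfl⟩ : ∃ e, d = e + 1 := ⟨d - 1, by omega⟩
    simp only [show 2 * (e + 1) - 1 = 2 * e + 1 by omega, show 2 * (e + 1) - 2 = 2 * e by omega] at h45 ⊢
    have h45' : (costCoeffZd (e + 1) 4 5 : ℤ) = 2 * (e + 1) * (2 * e + 1) ^ 3 - 2 * (e + 1) * (2 * e) := by
      have := congrArg (fun m : ℕ => (m : ℤ)) h45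
      push_cast at this
      linarith
    push_cast
    rw [h45']
    ring

/-- `a₁ = −2d` on `ℤ^{d+1}`. [cite: JansevanRensburgWhittington2013, §3.2 Theorem 8 (arXiv v4 p. 11)] -/
theorem aZd_one (d : ℕ) : CostSeries.a (costCoeffZd d) 1 = -(2 * d) := by
  rw [CostSeries.a_one, pS_one]

/-- `a₂ = 4d² + 2d` on `ℤ^{d+1}`. [cite: JansevanRensburgWhittington2013, §3.2 Theorem 8 (arXiv v4 p. 11)] -/
theorem aZd_two (d : ℕ) : CostSeries.a (costCoeffZd d) 2 = 4 * d ^ 2 + 2 * d := by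
  rw [CostSeries.a_two, pD_one, pS_one, pS_two]; ring

/-- `a₃ = −(8d³ + 12d² + 2d)` on `ℤ^{d+1}`. [cite: JansevanRensburgWhittington2013, §3.2 Theorem 8 (arXiv v4 p. 11)] -/
theorem aZd_three (d : ℕ) : CostSeries.a (costCoeffZd d) 3 = -(8 * d ^ 3 + 12 * d ^ 2 + 2 * d) := by
  rw [CostSeries.a_three, aZd_one, aZd_two, pD_one, pH_one, pD_two, pS_three]; ring

/-- `a₄ = 16d⁴ + 48d³ + 24d²` on `ℤ^{d+1}`. [cite: JansevanRensburgWhittington2013, §3.2 Theorem 8 (arXiv v4 p. 11)] -/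
theorem aZd_four (d : ℕ) : CostSeries.a (costCoeffZd d) 4 = 16 * d ^ 4 + 48 * d ^ 3 + 24 * d ^ 2 := by
  rw [CostSeries.a_four, aZd_one, aZd_two, aZd_three, pD_one, pH_one, pT_one, pD_two, pH_two, pD_three, pS_four]; ring

/-- ★★ **THE FOURTH COEFFICIENT: `c^{(d)}_4 = −4d²(2d+3)`** on `ℤ^{d+1}`, every dimension.
[cite: JansevanRensburgWhittington2013, §3.2 Theorem 8 (arXiv v4 p. 11)] -/
theorem largeForceCoeffZd_at_four (d : ℕ) : largeForceCoeffZd d 4 = -(4 * d ^ 2 * (2 * d + 3)) := by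
  have e1 : CostSeries.e (costCoeffZd d) 1 = 2 * d := largeForceCoeffZd_at_one d
  have e2 : CostSeries.e (costCoeffZd d) 2 = -(2 * (d : ℤ)) := largeForceCoeffZd_at_two d
  have e3 : CostSeries.e (costCoeffZd d) 3 = 2 * d * (2 * d + 1) := largeForceCoeffZd_at_three d
  show CostSeries.e (costCoeffZd d) 4 = _
  rw [CostSeries.e_four_eq, aZd_one, aZd_two, aZd_three, aZd_four, e1, e2, e3]
  ring

/-- `c_4 = −20` on `ℤ²` (agreeing with the certified value of `SAWPulledLargeForceFourthOrder`, here without certificates).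
[cite: JansevanRensburgWhittington2013, §3.2 Theorem 8 (arXiv v4 p. 11)] -/
theorem largeForceCoeff_four_eq : largeForceCoeff 4 = -20 := by
  rw [← largeForceCoeffZd_one 4, largeForceCoeffZd_at_four]; rfl

/-- ★★ **`e^{λ_B(y)} = y + 2d − 2d/y + 2d(2d+1)/y² − 4d²(2d+3)/y³ + O(1/y⁴)` on `ℤ^{d+1}`, every dimension.**
[cite: JansevanRensburgWhittington2013, §3.2 Theorem 8 (arXiv v4 p. 11)] -/
theorem exp_pulledBridgeFreeEnergy_fourth_order_zd (d : ℕ) :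
    ∃ C y₁ : ℝ, 0 < y₁ ∧ ∀ y ≥ y₁,
      |Real.exp (pulledBridgeFreeEnergy (d + 1) y) -
        (y + 2 * d - 2 * d / y + 2 * d * (2 * d + 1) / y ^ 2 - 4 * d ^ 2 * (2 * d + 3) / y ^ 3)| ≤ C / y ^ 4 := by
  obtain ⟨C, y₁, hy₁, h⟩ := exp_pulledBridgeFreeEnergy_expansion_zd d 4
  refine ⟨C, y₁, hy₁, fun y hy => ?_⟩
  have hy0 : 0 < y := lt_of_lt_of_le hy₁ hy
  have h1 := h y hy
  have hs : ∑ k ∈ Finset.range (4 + 1), y * ((largeForceCoeffZd d k : ℝ) * y⁻¹ ^ k) =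
      y + 2 * d - 2 * d / y + 2 * d * (2 * d + 1) / y ^ 2 - 4 * d ^ 2 * (2 * d + 3) / y ^ 3 := by
    rw [Finset.sum_range_succ, Finset.sum_range_succ, Finset.sum_range_succ, Finset.sum_range_succ, Finset.sum_range_one,
      largeForceCoeffZd_zero, largeForceCoeffZd_at_one, largeForceCoeffZd_at_two, largeForceCoeffZd_at_three,
      largeForceCoeffZd_at_four]
    push_cast
    field_simp
    ring
  rwa [hs] at h1

end Literature.Probability.RandomPlanarGeometry.SAW.Zd

end
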